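import Summits.QuantumFields.BalabanUV.Beta.GAN24.GaugeReadChargeComb
import Summits.QuantumFields.BalabanUV.Beta.GAN24.CoDressedFieldRowSums

/-!
# `BalabanUV.Beta.GAN24.GaugeReadColumnSums` — binder row G-an2-4 ∕ (CONV-C), CT-W «WC-TL», (Q-R) «QR-LL», the (S) row after RULING R-gan24p1-g28-1, piece (γ), the plain
# sub-row (T-F) of (W-γ): **THE COLUMN SUMS OF THE (γ) RESPONSE KERNEL `G ∘ D` ARE THE FIRST-LEG ROW TOTALS OF `G` READ AGAINST `D`** — `Σ'_u (G ∘ D)(u, x₂)(a, b) =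
# Σ'_p Σ_c (Σ'_u G(u,p)(a,c))·D(p, x₂)(c, b)` (one Fubini, generic decaying `G`, bi-localised `D`), and **UNDER THE FIELD–FIELD ROW LAW `Σ'_u G(u,p)(inl κ)(inl κ′) = 0` ONLY THE
# MULTIPLIER ROWS OF `D` SURVIVE** (road-P2 g39's E26g «`G_j·1^F_κ = (0, −Lc⁻¹·1^M_κ)`», typed by them as `CoDressedFieldRowSums` p327722 ✓ — consumed BY NAME for the literal in §3)
# (G-an2-4 formalisation swarm, unit `b2b-balaban-gan24-formalise-leaf-06`, gen 45; INTENT 6, sequel of INTENT 5 `GaugeReadChargeTotals`: its column sums `C_κκ₂` reduced).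

NOT IN PRINT; OUR BOOKKEEPING ([folklore]: one Fubini on `Site × Site` with the majorant `GaugeReadChargeDipole.summable_shifted_majorant`; `Fintype.sum_sum_type`; an2's
`vertexFamily_dM` for the literal slot derivative; 0 `def`, 0 cited fact, 0 `def … : Prop`, 0 sorry).  HONEST FRAMING (cell contract, verbatim): «discharging `BetaPertH` makes
Bałaban's UV stability UNCONDITIONAL — a real constructive-QFT result; it is NOT the continuum limit and NOT the Clay problem.»  HONEST DEPENDENCY (verbatim): «continuum YM on T⁴ ⇐
BetaPertH ∧ nine spine estimates (0/9 proved); BetaPertH ⇐ (D1) ∧ (D4) ∧ CAP+tail; G-an2-4 gates asym, D1 and NE2/3/4.»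
* §1 `summable_compPair`, **`tsum_comp_apply_eq_rowTotals`** (generic: `Decays G CG δG`, `BiLoc D p₀ q₀ CD δD`): `Σ'_u comp G D u x₂ a b = Σ'_p Σ_c (Σ'_u G u p a c)·D p x₂ c b`.
* §2 **`tsum_comp_apply_eq_multRows_of_ffRowZero`**: if `Σ'_u G u p (inl κ) (inl κ′) = 0` for all `p κ′` (displayed), then
  `Σ'_u comp G D u x₂ (inl κ) b = Σ'_p Σ_μ (Σ'_u G u p (inl κ)(inr μ))·D p x₂ (inr μ) b` — the (γ) column sums see ONLY the multiplier rows of the slot derivative.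
* §3 the LITERAL slot derivative `D = dM G_j Lc S_j M1_j ν y′` (bi-localised by an2's `vertexFamily_dM`): **`colSum_combResponse_eq_multRows`** — the column sums
  `C_κκ₂(x₂) = Σ'_u A_j(ν,y′) u x₂ (inl κ)(inl κ₂)` of INTENT 5's `hasSum_comb_gaugeCharge_eq_totals`, with the ff row law for `G_j` DISCHARGED by road-P2's
  `CoDressedFieldRowSums.tsum_coDressKBmAt_KInvStep_inl_inl_left` (NO displayed hypothesis left), equal
  `Σ'_p Σ_μ (Σ'_u G_j u p (inl κ)(inr μ))·(dM G_j Lc S_j M1_j ν y′) p x₂ (inr μ)(inl κ₂)` — so the (γ) total read weight `W^γ_κ` of (T-F) is a finite box sum of differences of THESE.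
Asserts NO value of any row total or table entry; the ff row law is road-P2 g39's theorem, used BY NAME;
(T-F) ∕ (W-γ) ∕ (INV) NOT claimed; discharges NOTHING of (S) ∕ (Q-R) ∕ (LT) ∕ (Q-L) ∕ (C) ∕ «T2Shape» ∕ «T2Drift» ∕ (hW, hWall); NEVER «G-an2-4 closed» as (CONV-C); NOT D1, NOT BetaPertH,
NOT continuum, NOT Clay.  2026-08-22; no existing file touched.
-/

noncomputable section

open Finset
open scoped BigOperators
open Literature.MathematicalPhysics.QuantumFieldTheory
open Literature.MathematicalPhysics.QuantumFieldTheory.Balaban1983to89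
open Literature.MathematicalPhysics.QuantumFieldTheory.Balaban1983to89.Beta
open B12Sec2to5 (l1 l1_nonneg)
open ExpKernelCalculus (Site MKer BiLoc Decays VertexFamily Zl Zl_nonneg comp summable_exp_shift' tsum_exp_shift' l1_sub_symm)
open AffineAveraging (box toSite)
open OneStepResolventKernel (Fib LocStencil)
open OneStepKernelFamily (KInvStep)
open BalabanStepJets (locStencil_mono)
open SecondOrderResponse (dM vertexFamily_dM)
open Summit.QuantumFields.BalabanUV.Beta.AxialDressingRooted (coDressKBmAt decays_coDressKBmAt_KInvStep)
open Summit.QuantumFields.BalabanUV.Beta.SpineRooted (SpureRecAt M1At locStencil_SpureRecAt vertexFamily_M1At)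
open Summit.QuantumFields.BalabanUV.Beta.GAN24.GaugeReadChargeDipole (summable_shifted_majorant)
open Summit.QuantumFields.BalabanUV.Beta.GAN24.CoDressedFieldRowSums (tsum_coDressKBmAt_KInvStep_inl_inl_left)

namespace Summit.QuantumFields.BalabanUV.Beta.GAN24.GaugeReadColumnSums

variable {d : ℕ}

/-! ## §1 The column sums of a composition are the first-leg row totals read against the second factor -/

/-- [folklore] The composition series of a decaying `G` and a bi-localised `D`, as a family on (middle point, first leg), is absolutely summable:
`(p, u) ↦ Σ_c G u p a c·D p x₂ c b` has the majorant `|Fib|·CG·CD·e^{−δD‖p − p₀‖₁}·e^{−δG‖u − p‖₁}`. -/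
theorem summable_compPair {G D : MKer (d + 1) (Fib d)} {CG δG CD δD : ℝ} {p₀ q₀ : Site (d + 1)} (hG : Decays G CG δG) (hδG : 0 < δG)
    (hD : BiLoc D p₀ q₀ CD δD) (hδD : 0 < δD) (x₂ : Site (d + 1)) (a b : Fib d) :
    Summable (Function.uncurry fun (p u : Site (d + 1)) => ∑ c, G u p a c * D p x₂ c b) := by
  have hCG : 0 ≤ CG := hG.nonneg a
  have hmaj := summable_shifted_majorant (d := d) hδD hδG ((Fintype.card (Fib d) : ℝ) * (CG * CD)) p₀ (fun p => p)
  refine Summable.of_norm_bounded hmaj (fun pu => ?_)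
  rw [Real.norm_eq_abs]
  show |∑ c, G pu.2 pu.1 a c * D pu.1 x₂ c b| ≤ _
  calc |∑ c, G pu.2 pu.1 a c * D pu.1 x₂ c b| ≤ ∑ c, |G pu.2 pu.1 a c * D pu.1 x₂ c b| := Finset.abs_sum_le_sum_abs _ _
    _ ≤ ∑ _c : Fib d, (CG * CD) * (Real.exp (-δD * l1 (pu.1 - p₀)) * Real.exp (-δG * l1 (pu.2 - pu.1))) :=
        Finset.sum_le_sum fun c _ => by
          rw [abs_mul]
          have h1 := hG pu.2 pu.1 a c
          have h2 := hD pu.1 x₂ c b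
          have h3 : Real.exp (-δD * (l1 (pu.1 - p₀) + l1 (x₂ - q₀))) ≤ Real.exp (-δD * l1 (pu.1 - p₀)) := by
            rw [Real.exp_le_exp]; nlinarith [l1_nonneg (x₂ - q₀)]
          calc |G pu.2 pu.1 a c| * |D pu.1 x₂ c b| ≤ (CG * Real.exp (-δG * l1 (pu.2 - pu.1))) * (CD * Real.exp (-δD * (l1 (pu.1 - p₀) + l1 (x₂ - q₀)))) :=
                mul_le_mul h1 h2 (abs_nonneg _) ((abs_nonneg _).trans h1)
            _ ≤ (CG * Real.exp (-δG * l1 (pu.2 - pu.1))) * (CD * Real.exp (-δD * l1 (pu.1 - p₀))) :=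
                mul_le_mul_of_nonneg_left (mul_le_mul_of_nonneg_left h3 (hD.nonneg c)) (by positivity)
            _ = (CG * CD) * (Real.exp (-δD * l1 (pu.1 - p₀)) * Real.exp (-δG * l1 (pu.2 - pu.1))) := by ring
    _ = (Fintype.card (Fib d) : ℝ) * (CG * CD) * (Real.exp (-δD * l1 (pu.1 - p₀)) * Real.exp (-δG * l1 (pu.2 - pu.1))) := by
        rw [Finset.sum_const, Finset.card_univ, nsmul_eq_mul]; ring

/-- NOT IN PRINT; OUR BOOKKEEPING.  **THE COLUMN SUMS OF A COMPOSITION ARE THE FIRST-LEG ROW TOTALS OF THE FIRST FACTOR READ AGAINST THE SECOND**: for a decaying `G` and a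
bi-localised `D`, `Σ'_u comp G D u x₂ a b = Σ'_p Σ_c (Σ'_u G u p a c)·D p x₂ c b` (Fubini on §1's family, then the finite channel sum and `tsum_mul_right`). -/
theorem tsum_comp_apply_eq_rowTotals {G D : MKer (d + 1) (Fib d)} {CG δG CD δD : ℝ} {p₀ q₀ : Site (d + 1)} (hG : Decays G CG δG) (hδG : 0 < δG)
    (hD : BiLoc D p₀ q₀ CD δD) (hδD : 0 < δD) (x₂ : Site (d + 1)) (a b : Fib d) :
    ∑' u, comp G D u x₂ a b = ∑' p, ∑ c, (∑' u, G u p a c) * D p x₂ c b := by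
  have hs := summable_compPair hG hδG hD hδD x₂ a b
  -- `comp G D u x₂ a b = Σ'_p Σ_c G u p a c·D p x₂ c b`; exchange the two infinite sums
  have hcomm : ∑' u, ∑' p, (∑ c, G u p a c * D p x₂ c b) = ∑' p, ∑' u, (∑ c, G u p a c * D p x₂ c b) := hs.tsum_comm
  have e1 : ∀ u, comp G D u x₂ a b = ∑' p, ∑ c, G u p a c * D p x₂ c b := fun u => by simp only [comp]
  rw [tsum_congr e1, hcomm]
  refine tsum_congr fun p => ?_
  -- each first-leg column `u ↦ G u p a c` is summable
  have hcol : ∀ c : Fib d, Summable fun u : Site (d + 1) => G u p a c * D p x₂ c b := fun c => by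
    have h0 : Summable fun u : Site (d + 1) => G u p a c :=
      Summable.of_norm_bounded ((summable_exp_shift' hδG p).mul_left CG) (fun u => by rw [Real.norm_eq_abs]; exact hG u p a c)
    exact h0.mul_right _
  rw [Summable.tsum_finsetSum (fun c _ => hcol c)]
  exact Finset.sum_congr rfl fun c _ => by rw [tsum_mul_right]

/-! ## §2 Under the field–field row law only the multiplier rows of the second factor survive -/

/-- NOT IN PRINT; OUR BOOKKEEPING.  **UNDER THE FIELD–FIELD ROW LAW, THE (γ) COLUMN SUMS SEE ONLY THE MULTIPLIER ROWS OF THE SLOT DERIVATIVE**: if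
`Σ'_u G u p (inl κ) (inl κ′) = 0` for every `p, κ′` (DISPLAYED — road-P2 g39's E26g; staged by them as `CoDressedFieldRowSums.tsum_coDressKBmAt_KInvStep_inl_inl_left`), then
`Σ'_u comp G D u x₂ (inl κ) b = Σ'_p Σ_μ (Σ'_u G u p (inl κ)(inr μ))·D p x₂ (inr μ) b`. -/
theorem tsum_comp_apply_eq_multRows_of_ffRowZero {G D : MKer (d + 1) (Fib d)} {CG δG CD δD : ℝ} {p₀ q₀ : Site (d + 1)} (hG : Decays G CG δG) (hδG : 0 < δG)
    (hD : BiLoc D p₀ q₀ CD δD) (hδD : 0 < δD) (κ : Fin (d + 1))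
    (hRff : ∀ (p : Site (d + 1)) (κ' : Fin (d + 1)), ∑' u, G u p (Sum.inl κ) (Sum.inl κ') = 0) (x₂ : Site (d + 1)) (b : Fib d) :
    ∑' u, comp G D u x₂ (Sum.inl κ) b = ∑' p, ∑ μ, (∑' u, G u p (Sum.inl κ) (Sum.inr μ)) * D p x₂ (Sum.inr μ) b := by
  rw [tsum_comp_apply_eq_rowTotals hG hδG hD hδD x₂ (Sum.inl κ) b]
  refine tsum_congr fun p => ?_
  rw [Fintype.sum_sum_type]
  simp only [hRff, zero_mul, Finset.sum_const_zero, zero_add]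

/-! ## §3 The literal comb response kernel's column sums -/

/-- NOT IN PRINT; OUR BOOKKEEPING.  **THE COLUMN SUMS OF THE LITERAL (γ) RESPONSE KERNEL, REDUCED BY THE ROW LAW.**  For `G_j = coDressKBmAt ρ Lc (KInvStep Lc j)` (in-block root),
the tables `S_j = SpureRecAt … j`, `M1_j = M1At … j`, a slot `(ν, y′)`, and the slot derivative `D := dM G_j Lc S_j M1_j ν y′` (bi-localised at `Lc•y′` by an2's `vertexFamily_dM`):
the column sums of `A_j(ν,y′) = G_j ∘ D` — the field–field row law `Σ'_u G_j u p (inl κ)(inl κ′) = 0` being road-P2 g39's `tsum_coDressKBmAt_KInvStep_inl_inl_left` (p327722 ✓) — that INTENT 5's `GaugeReadChargeTotals.hasSum_comb_gaugeCharge_eq_totals`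
reads at the `2(d+1)Lc^{d+1}` points `Lc•y + v − e_κ₂`, `Lc•y + v` are `C_κκ₂(x₂) = Σ'_p Σ_μ (Σ'_u G_j u p (inl κ)(inr μ))·D p x₂ (inr μ)(inl κ₂)` — the (inr, inl) = multiplier-row ∕ field-column
block of the slot derivative read against the first-leg field-to-multiplier row totals of `G_j` (road-P2 g39's `tsum_colH_comb_eq` gives those totals on the coarse lattice).  The (γ)
half of (T-F) is thereby a finite identity about border-table entries; (T-F) itself is NOT claimed. -/
theorem colSum_combResponse_eq_multRows {Lc : ℕ} [NeZero Lc] (hLc : 1 ≤ Lc) {r : Fin (d + 1) → ℕ} (hr : r ∈ box (d + 1) Lc) (cE cVH cΛ : ℝ) (j : ℕ)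
    (ν : Fin (d + 1)) (y' : Site (d + 1)) (κ κ₂ : Fin (d + 1)) (x₂ : Site (d + 1)) :
    ∑' u, comp (coDressKBmAt (toSite r) Lc (KInvStep (d := d) Lc j))
        (dM (coDressKBmAt (toSite r) Lc (KInvStep (d := d) Lc j)) Lc (SpureRecAt d Lc (toSite r) cE cVH cΛ j) (M1At d Lc (toSite r) cΛ j) ν y') u x₂ (Sum.inl κ) (Sum.inl κ₂)
      = ∑' p, ∑ μ, (∑' u, coDressKBmAt (toSite r) Lc (KInvStep (d := d) Lc j) u p (Sum.inl κ) (Sum.inr μ))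
          * dM (coDressKBmAt (toSite r) Lc (KInvStep (d := d) Lc j)) Lc (SpureRecAt d Lc (toSite r) cE cVH cΛ j) (M1At d Lc (toSite r) cΛ j) ν y' p x₂
              (Sum.inr μ) (Sum.inl κ₂) := by
  obtain ⟨δG, CG, hδG, hCG, hG⟩ := decays_coDressKBmAt_KInvStep (d := d) hr j
  obtain ⟨Cs, δs, hδs, hS⟩ := locStencil_SpureRecAt (d := d) (Lc := Lc) hLc hr cE cVH cΛ j
  have hCs : 0 ≤ Cs := (hS 0 0).nonneg (Sum.inl 0)
  set m : ℝ := min δs δG with hm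
  have hm0 : 0 < m := lt_min hδs hδG
  have hSm : LocStencil (SpureRecAt d Lc (toSite r) cE cVH cΛ j) Cs m := locStencil_mono hS hCs (min_le_left _ _)
  have hMm := vertexFamily_M1At (d := d) hLc hr cΛ j hm0.le
  have hV := vertexFamily_dM (N := Lc) hG hCG hSm hMm hm0 (min_le_right _ _)
  exact tsum_comp_apply_eq_multRows_of_ffRowZero hG hδG (hV ν y') (half_pos hm0) κ
    (fun p κ' => tsum_coDressKBmAt_KInvStep_inl_inl_left hr j p κ κ') x₂ (Sum.inl κ₂)

end Summit.QuantumFields.BalabanUV.Beta.GAN24.GaugeReadColumnSums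

end
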